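/-
Copyright (c) 2026. All rights reserved.
Released under Apache 2.0 license as described in the file LICENSE.
Authors: HodgeCM publication cell (pub-hodgecm), GR lane, seat GR-2 (`pub-hodgecm-own-hyp34`).
-/
import Mathlib.GroupTheory.Abelianization.Defs
import Literature.NumberTheory.Weil1964.AdelicMetaplecticTwistCharacter
import Literature.NumberTheory.Weil1964.AdelicMetaplecticRationalLift
import Literature.RepresentationTheory.HeisenbergGroup.SymplecticAbelianization
import HarnessLib

/-!
# `π : Mp_ψ(W_𝔸)ᶜᵒⁿᵗ → Sp(W_𝔸)` splits UNIQUELY over the rational symplectic group `Sp(W)(F)`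

Topic `NumberTheory/Weil1964`; namespace `Literature.NumberTheory.Weil1964`.  KERNEL MATHEMATICS ONLY: theorems; no
definition, no named fact, no `axiom`, no proof hole.  Sequel of `AdelicMetaplecticTwistCharacter` (two homomorphisms
into `Mp_ψ(W_𝔸)ᶜᵒⁿᵗ` over the same symplectic map differ by a character, because `ker π` is the group of central scalars,
`AdelicMetaplecticKernel`) and `AdelicMetaplecticRationalLift` (Weil's Θ-rigid section
`ratThetaLiftContι : Sp_{2ι}(F) →* Mp_ψ(W_𝔸)ᶜᵒⁿᵗ` over `ratSpι : Sp_{2ι}(F) → Sp(W_𝔸)`), closed by the perfectness of the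
symplectic group (`SymplecticAbelianization`: `Sp_{2ι}(𝕜)` has no non-trivial homomorphism to an abelian group in
characteristic `0`).

THE PRINTED SENTENCE.  [GelbartRogawski1991, §3.1 p. 454 L35–36] (verbatim): "*It is known ([We]) that `π` splits
uniquely over the group of `F`-rational points `Sp_F(W)`. We denote this splitting by `i`.*"  ([We] = [Weil1964]; Weil
proves EXISTENCE of `r_k : Sp(X_k) → Mp(X_A)` with `π ∘ r_k = id`, Chap. III n° 40 p. 190, and that its operators fix the
theta distribution, n° 41 Thm 6 p. 193; the UNIQUENESS is the remark that two sections differ by a character of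
`Sp(X_k)`, which is its own commutator group — [MoeglinVignerasWaldspurger1987, Chap. 2 II.1 (B)] "*`M` est unique à un
scalaire près*" with II.2, and [Folland1989, §4.1 Prop. (4.21)].)

Until now the tree had the uniqueness of Weil's section only AMONG Θ-FIXING sections
(`coe_ratThetaLiftContι_eq`, `thetaFixing_unique` — Θ-rigidity), and the object-match note (b) of
`GelbartRogawski1991/CompatibleSplitting.lean` identified the record's `ratSplit` with print's `i` through Θ-rigidity.
This file proves the printed uniqueness outright, for the metaplectic group OF RECORD `Mp_ψ(W_𝔸)ᶜᵒⁿᵗ = adelicMpCont F ι T`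
(LF-continuous implementing pairs of the global Schrödinger model on `𝒮(𝔸_F^ι)`, invertible Gram matrix `T`):

* §1 (engine, any source group `H`) `adelicMpCont.eq_of_proj_eq_of_forall_hom_eq_one` — if `H` has no non-trivial
  character `H →* ℂˣ`, two homomorphisms `s₁ s₂ : H →* Mp_ψ(W_𝔸)ᶜᵒⁿᵗ` with `π ∘ s₁ = π ∘ s₂` are EQUAL (the character of
  `adelicMpCont.exists_eq_twist` is trivial); the same under `commutator H = ⊤` (`…_of_commutator_eq_top`), with the
  bookkeeping `commutator_symplecticGroup_eq_top` (`Sp_{2ι}(𝕜)` is perfect, from `SymplecticMatrix.hom_eq_one` through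
  Mathlib's `Abelianization`).
* §2 (the printed sentence) **`ratThetaLiftContι_unique`** — every homomorphism `s : Sp_{2ι}(F) →* Mp_ψ(W_𝔸)ᶜᵒⁿᵗ`
  with `π (s γ) = ratSpι γ` for all `γ` IS Weil's `r_F = ratThetaLiftContι`; packaged as
  **`existsUnique_ratSection`** (`∃! s, π ∘ s = ratSpι` — "π splits uniquely over `Sp_F(W)`"), the two-section form
  `eq_of_proj_eq_ratSpι`, the `Fin n` form `ratThetaLiftCont_unique` (generators file's `r_F`), and the RANGE form
  `ratPointsThetaLiftCont_unique` for the subgroup `Sp(W)(F) = range (transportSp T ∘ mapHom ι_𝔸) ≤ Sp(W_𝔸)` (the shape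
  of the `ratSplit` field of `GelbartRogawski1991.SplittingDatum`).
* §3 (consequence) every section over the rational points AUTOMATICALLY fixes the theta distribution
  (`mem_adelicMpTheta_of_proj_eq_ratSpι`, `thetaDist_omega_of_proj_eq_ratSpι`): Θ-invariance of `r_F(γ)`
  ([Weil1964] Thm 6) is a property of THE rational section, not an extra normalisation.

Scope (what is NOT here): print's `Mp_𝐀(W)` acts on the Hilbert space of a unitary `ρ_ψ` (bounded `M_g`); for that
model the same argument needs `ker π =` scalars there, i.e. Schur's lemma for the irreducible unitary `ρ_ψ` (kernel
theorem `HodgeCM.PerL34.Schur.eq_scalar_of_commute` of the HodgeCM package; not imported into `Literature`), and the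
perfectness of the abstract `Sp_F(W)` of a symplectic `F`-space (transport of `commutator_symplecticGroup_eq_top` along
a symplectic basis) — neither is asserted here.  Nothing of [Weil1964] / [GelbartRogawski1991] /
[MoeglinVignerasWaldspurger1987] is used as a hypothesis; the cite tags are provenance.

## References
* [GelbartRogawski1991] S. Gelbart, J. Rogawski, *L-functions and Fourier–Jacobi coefficients for the unitary group
  U(3)*, Invent. Math. 105 (1991) 445–472, §3.1 p. 454 L35–36.
* [Weil1964] A. Weil, *Sur certains groupes d'opérateurs unitaires*, Acta Math. 111 (1964) 143–211, Chap. III n° 40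
  p. 190 (`r_k`), n° 41 Thm 6 p. 193.
* [MoeglinVignerasWaldspurger1987] C. Mœglin, M.-F. Vignéras, J.-L. Waldspurger, *Correspondances de Howe sur un corps
  p-adique*, LNM 1291 (1987), Chap. 2 II.1 (B), II.2.
* [Folland1989] G. B. Folland, *Harmonic Analysis in Phase Space*, Ann. of Math. Stud. 122 (1989), §4.1 Prop. (4.21).
-/

set_option autoImplicit false

noncomputable section

open scoped Matrix
open NumberField

namespace Literature.NumberTheory.Weil1964

open Literature.NumberTheory.Automorphic Literature.RepresentationTheory.HeisenbergGroup
open Literature.RepresentationTheory.HeisenbergGroup.SymplecticMatrix (transportSp mapHom)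

/-! ## §1 Engine: two homomorphisms over the same symplectic map from a group without characters coincide -/

section Engine

variable {F : Type} [Field F] [NumberField F] {ι : Type} [Fintype ι] [DecidableEq ι]
  {T : Matrix ι ι (AdeleRing (𝓞 F) F)}
variable {H : Type*} [Group H]

/-- **A group all of whose characters `H →* ℂˣ` are trivial has at most ONE homomorphism into `Mp_ψ(W_𝔸)ᶜᵒⁿᵗ` over a
given map to `Sp(W_𝔸)`** (`T` invertible): by `adelicMpCont.exists_eq_twist` the second is the twist of the first by a
character, which is `1`. [cite: MoeglinVignerasWaldspurger1987, Chap. 2 II.1 (B)] -/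
theorem adelicMpCont.eq_of_proj_eq_of_forall_hom_eq_one (hT : IsUnit T) (hH : ∀ χ : H →* ℂˣ, χ = 1)
    (s₁ s₂ : H →* adelicMpCont F ι T)
    (hproj : ∀ h : H, adelicMpCont.proj F ι T (s₁ h) = adelicMpCont.proj F ι T (s₂ h)) : s₁ = s₂ :=
  (adelicMpCont.exists_eq_twist s₁ s₂ hT hproj).elim fun χ hχ =>
    (MonoidHom.ext fun h =>
      (adelicMpCont.twist_eq_of_eq_one s₁ χ
        ((DFunLike.congr_fun (hH χ) h).trans (MonoidHom.one_apply h))).symm).trans hχ.symm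

/-- a perfect group (`commutator H = ⊤`) has no non-trivial homomorphism to a commutative group (plumbing for the
next theorem; Mathlib's `Abelianization.commutator_subset_ker`). [folklore] -/
private theorem monoidHom_eq_one_of_commutator_eq_top (hH : commutator H = ⊤) {C : Type*} [CommGroup C] (χ : H →* C) :
    χ = 1 :=
  MonoidHom.ext fun h => (MonoidHom.mem_ker).1 (Abelianization.commutator_subset_ker χ (by
    rw [hH]; exact Subgroup.mem_top h))

/-- the engine under the hypothesis `commutator H = ⊤`. [cite: MoeglinVignerasWaldspurger1987, Chap. 2 II.1 (B)] -/
theorem adelicMpCont.eq_of_proj_eq_of_commutator_eq_top (hT : IsUnit T) (hH : commutator H = ⊤)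
    (s₁ s₂ : H →* adelicMpCont F ι T)
    (hproj : ∀ h : H, adelicMpCont.proj F ι T (s₁ h) = adelicMpCont.proj F ι T (s₂ h)) : s₁ = s₂ :=
  adelicMpCont.eq_of_proj_eq_of_forall_hom_eq_one hT (fun χ => monoidHom_eq_one_of_commutator_eq_top hH χ) s₁ s₂
    hproj

/-- **`Sp_{2l}(𝕜)` is perfect** (characteristic `0`): its commutator subgroup is everything — the subgroup form of
`SymplecticMatrix.hom_eq_one` (the abelianization map is a homomorphism to a commutative group, hence trivial, and its
kernel is the commutator subgroup). [cite: Folland1989, §4.1 Prop. (4.21)] -/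
theorem commutator_symplecticGroup_eq_top (l : Type*) [DecidableEq l] [Fintype l] (𝕜 : Type*) [Field 𝕜]
    [CharZero 𝕜] : commutator (Matrix.symplecticGroup l 𝕜) = ⊤ := by
  rw [← Abelianization.ker_of, SymplecticMatrix.hom_eq_one (Abelianization.of (G := Matrix.symplecticGroup l 𝕜))]
  exact MonoidHom.ker_one

end Engine

/-! ## §2 The printed sentence: `π` splits uniquely over `Sp(W)(F)` -/

section Rational

variable (F : Type) [Field F] [NumberField F] (ι : Type) [Fintype ι] [DecidableEq ι]
  (T : Matrix ι ι (AdeleRing (𝓞 F) F)) (hT : IsUnit T.det)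

include hT in
/-- **Two homomorphic sections of `π` over the rational symplectic group coincide**: if
`s₁ s₂ : Sp_{2ι}(F) →* Mp_ψ(W_𝔸)ᶜᵒⁿᵗ` lie over the same map to `Sp(W_𝔸)` they are equal (`Sp_{2ι}(F)` is perfect,
`F` a number field; `det T` a unit). [cite: GelbartRogawski1991, §3.1 p. 454 L35–36] -/
theorem adelicMpCont.eq_of_proj_eq_symplecticGroup (s₁ s₂ : Matrix.symplecticGroup ι F →* adelicMpCont F ι T)
    (hproj : ∀ γ, adelicMpCont.proj F ι T (s₁ γ) = adelicMpCont.proj F ι T (s₂ γ)) : s₁ = s₂ :=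
  adelicMpCont.eq_of_proj_eq_of_forall_hom_eq_one ((Matrix.isUnit_iff_isUnit_det T).2 hT)
    (fun χ => SymplecticMatrix.hom_eq_one χ) s₁ s₂ hproj

/-- **[GR91 p. 454 L35–36] "`π` splits uniquely over `Sp_F(W)`; we denote this splitting by `i`" — uniqueness, as a
kernel theorem for `Mp_ψ(W_𝔸)ᶜᵒⁿᵗ`**: every homomorphism `s : Sp_{2ι}(F) →* Mp_ψ(W_𝔸)ᶜᵒⁿᵗ` with `π (s γ) = ratSpι γ`
for all `γ` IS Weil's section `r_F = ratThetaLiftContι`.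
[cite: GelbartRogawski1991, §3.1 p. 454 L35–36; Weil1964, Chap. III n° 40 p. 190] -/
theorem ratThetaLiftContι_unique (s : Matrix.symplecticGroup ι F →* adelicMpCont F ι T)
    (hs : ∀ γ, adelicMpCont.proj F ι T (s γ) = ratSpι F ι T hT γ) : s = ratThetaLiftContι F ι T hT :=
  adelicMpCont.eq_of_proj_eq_symplecticGroup F ι T hT s _ fun γ =>
    (hs γ).trans (proj_ratThetaLiftContι F ι T hT γ).symm

/-- pointwise form of `ratThetaLiftContι_unique`. [cite: GelbartRogawski1991, §3.1 p. 454 L35–36] -/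
theorem eq_ratThetaLiftContι_apply (s : Matrix.symplecticGroup ι F →* adelicMpCont F ι T)
    (hs : ∀ γ, adelicMpCont.proj F ι T (s γ) = ratSpι F ι T hT γ) (γ : Matrix.symplecticGroup ι F) :
    s γ = ratThetaLiftContι F ι T hT γ :=
  congrArg (fun t : Matrix.symplecticGroup ι F →* adelicMpCont F ι T => t γ) (ratThetaLiftContι_unique F ι T hT s hs)

/-- two sections of `π` over `ratSpι` coincide (no reference to `r_F`). [cite: GelbartRogawski1991, §3.1 p. 454 L35–36] -/
theorem eq_of_proj_eq_ratSpι (s₁ s₂ : Matrix.symplecticGroup ι F →* adelicMpCont F ι T)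
    (h₁ : ∀ γ, adelicMpCont.proj F ι T (s₁ γ) = ratSpι F ι T hT γ)
    (h₂ : ∀ γ, adelicMpCont.proj F ι T (s₂ γ) = ratSpι F ι T hT γ) : s₁ = s₂ :=
  (ratThetaLiftContι_unique F ι T hT s₁ h₁).trans (ratThetaLiftContι_unique F ι T hT s₂ h₂).symm

/-- **"`π` splits uniquely over `Sp_F(W)`" — existence and uniqueness in one statement**: there is exactly one
homomorphism `s : Sp_{2ι}(F) →* Mp_ψ(W_𝔸)ᶜᵒⁿᵗ` with `π ∘ s = ratSpι` (namely Weil's `r_F`).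
[cite: GelbartRogawski1991, §3.1 p. 454 L35–36; Weil1964, Chap. III n° 40 p. 190] -/
theorem existsUnique_ratSection :
    ∃! s : Matrix.symplecticGroup ι F →* adelicMpCont F ι T, ∀ γ, adelicMpCont.proj F ι T (s γ) = ratSpι F ι T hT γ :=
  ⟨ratThetaLiftContι F ι T hT, proj_ratThetaLiftContι F ι T hT, fun s hs => ratThetaLiftContι_unique F ι T hT s hs⟩

/-- the `Fin n` form: a section over `ratSp` IS `ratThetaLiftCont` of `AdelicMetaplecticGenerators`.
[cite: GelbartRogawski1991, §3.1 p. 454 L35–36; Weil1964, Chap. III n° 40 p. 190] -/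
theorem ratThetaLiftCont_unique {n : ℕ} (T : Matrix (Fin n) (Fin n) (AdeleRing (𝓞 F) F)) (hT : IsUnit T.det)
    (s : Matrix.symplecticGroup (Fin n) F →* adelicMpCont F (Fin n) T)
    (hs : ∀ γ, adelicMpCont.proj F (Fin n) T (s γ) = ratSp F T hT γ) : s = ratThetaLiftCont F T hT :=
  (ratThetaLiftContι_unique F (Fin n) T hT s hs).trans (MonoidHom.ext fun γ => ratThetaLiftContι_fin F T hT γ)

/-- **Range form** (the shape of the `ratSplit` field of `GelbartRogawski1991.SplittingDatum`): on the subgroup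
`Sp(W)(F) = range (transportSp T ∘ mapHom ι_𝔸) ≤ Sp(W_𝔸)` of rational points, every homomorphic section of `π` IS
`ratPointsThetaLiftCont = r_F ∘ (ratSpιRangeEquiv)⁻¹`. [cite: GelbartRogawski1991, §3.1 p. 454 L35–36] -/
theorem ratPointsThetaLiftCont_unique
    (j : ((transportSp T hT).comp (mapHom (algebraMap F (AdeleRing (𝓞 F) F)))).range →* adelicMpCont F ι T)
    (hj : ∀ x, adelicMpCont.proj F ι T (j x) = (x : symplecticGroup (polar (adelicForm F ι T)))) :
    j = ratPointsThetaLiftCont F ι T hT := by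
  have hcomp : j.comp (ratSpιRangeEquiv F ι T hT).toMonoidHom = ratThetaLiftContι F ι T hT :=
    ratThetaLiftContι_unique F ι T hT _ fun γ =>
      (hj (ratSpιRangeEquiv F ι T hT γ)).trans (coe_ratSpιRangeEquiv F ι T hT γ)
  refine MonoidHom.ext fun x => ?_
  exact (congrArg (fun y => j y) ((ratSpιRangeEquiv F ι T hT).apply_symm_apply x).symm).trans
    ((DFunLike.congr_fun hcomp ((ratSpιRangeEquiv F ι T hT).symm x)).trans
      (ratPointsThetaLiftCont_apply F ι T hT x).symm)

/-- two sections over the subgroup of rational points coincide. [cite: GelbartRogawski1991, §3.1 p. 454 L35–36] -/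
theorem eq_of_proj_eq_coe_ratPoints
    (j₁ j₂ : ((transportSp T hT).comp (mapHom (algebraMap F (AdeleRing (𝓞 F) F)))).range →* adelicMpCont F ι T)
    (h₁ : ∀ x, adelicMpCont.proj F ι T (j₁ x) = (x : symplecticGroup (polar (adelicForm F ι T))))
    (h₂ : ∀ x, adelicMpCont.proj F ι T (j₂ x) = (x : symplecticGroup (polar (adelicForm F ι T)))) : j₁ = j₂ :=
  (ratPointsThetaLiftCont_unique F ι T hT j₁ h₁).trans (ratPointsThetaLiftCont_unique F ι T hT j₂ h₂).symm

end Rational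

/-! ## §3 Consequence: every rational section fixes the theta distribution -/

section Theta

variable (F : Type) [Field F] [NumberField F] (ι : Type) [Fintype ι] [DecidableEq ι]
  (T : Matrix ι ι (AdeleRing (𝓞 F) F)) (hT : IsUnit T.det)

/-- **Θ-invariance is automatic**: if `s : Sp_{2ι}(F) →* Mp_ψ(W_𝔸)ᶜᵒⁿᵗ` is ANY homomorphic section of `π` over
`ratSpι`, then every `s γ` fixes the theta distribution ([Weil1964] Thm 6 for `r_F`, transported by uniqueness).
[cite: Weil1964, Chap. III n° 41 Thm 6 p. 193; GelbartRogawski1991, §3.1 p. 454 L35–36] -/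
theorem mem_adelicMpTheta_of_proj_eq_ratSpι (s : Matrix.symplecticGroup ι F →* adelicMpCont F ι T)
    (hs : ∀ γ, adelicMpCont.proj F ι T (s γ) = ratSpι F ι T hT γ) (γ : Matrix.symplecticGroup ι F) :
    (s γ : adelicMp F ι T) ∈ adelicMpTheta F ι T :=
  (eq_ratThetaLiftContι_apply F ι T hT s hs γ).symm ▸ coe_ratThetaLiftContι_mem_adelicMpTheta F ι T hT γ

/-- `Θ(ω(s γ) Φ) = Θ(Φ)` for ANY section `s` over the rational points.
[cite: Weil1964, Chap. III n° 41 Thm 6 p. 193; GelbartRogawski1991, §3.1 p. 454 L35–36] -/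
theorem thetaDist_omega_of_proj_eq_ratSpι (s : Matrix.symplecticGroup ι F →* adelicMpCont F ι T)
    (hs : ∀ γ, adelicMpCont.proj F ι T (s γ) = ratSpι F ι T hT γ) (γ : Matrix.symplecticGroup ι F)
    (Φ : piSchwartzBruhat F ι) :
    thetaDist F ι ((adelicMpCont.omega F ι T (s γ) Φ : piSchwartzBruhat F ι) : (ι → AdeleRing (𝓞 F) F) → ℂ) =
      thetaDist F ι (Φ : (ι → AdeleRing (𝓞 F) F) → ℂ) := by
  rw [eq_ratThetaLiftContι_apply F ι T hT s hs γ]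
  exact thetaDist_omega_ratThetaLiftContι F ι T hT γ Φ

/-- range form: a section over the subgroup of rational points of `Sp(W_𝔸)` fixes `Θ` at every rational point.
[cite: Weil1964, Chap. III n° 41 Thm 6 p. 193; GelbartRogawski1991, §3.1 p. 454 L35–36] -/
theorem mem_adelicMpTheta_of_proj_eq_coe_ratPoints
    (j : ((transportSp T hT).comp (mapHom (algebraMap F (AdeleRing (𝓞 F) F)))).range →* adelicMpCont F ι T)
    (hj : ∀ x, adelicMpCont.proj F ι T (j x) = (x : symplecticGroup (polar (adelicForm F ι T))))
    (x : ((transportSp T hT).comp (mapHom (algebraMap F (AdeleRing (𝓞 F) F)))).range) :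
    (j x : adelicMp F ι T) ∈ adelicMpTheta F ι T :=
  (congrArg (fun t : _ →* adelicMpCont F ι T => t x) (ratPointsThetaLiftCont_unique F ι T hT j hj)).symm ▸
    coe_ratPointsThetaLiftCont_mem_adelicMpTheta F ι T hT x

end Theta

end Literature.NumberTheory.Weil1964

end
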